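import Summits.Langlands.Langlands.Theorems.IrreducibilityBySelfDualityPairLBoundaryJS
import Summits.Langlands.Langlands.Theorems.IrreducibilityBySelfDualityPairLBoundaryJSSsv
import Summits.Langlands.Langlands.Theorems.IrreducibilityBySelfDualityPairLBoundaryJSStandardEntire
import Summits.Langlands.Langlands.Theorems.IrreducibilityBySelfDualityPairLBoundaryJSIsOrthoOfLocalTranslate
import Summits.Langlands.Langlands.Theorems.IrreducibilityBySelfDualityPairLBoundaryJSEqConjOfLocalTranslate
import Summits.Langlands.Langlands.Theorems.IrreducibilityBySelfDualityPairLBoundaryJSLocalPairTranslate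
import Summits.Langlands.Langlands.Theorems.IrreducibilityBySelfDualityPairLBoundaryJSOfHumphriesJo
import Literature.NumberTheory.Automorphic.PairLFunctionMeromorphicContinuationRankNeTwistProofs
import Literature.NumberTheory.Automorphic.ArchRankinSelbergTestVector
import Literature.NumberTheory.Automorphic.JPSSGlobalIntegralQuotientUnfolding
import Literature.NumberTheory.Automorphic.JPSSCornerWhittakerUnfolding
import Literature.NumberTheory.Automorphic.WhittakerPeriodExchange
import Literature.NumberTheory.Automorphic.TorusIwasawaTransport
import Literature.NumberTheory.Automorphic.CornerTorusIwasawaData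
import Literature.NumberTheory.Automorphic.WhittakerCoeffHonestCuspForm
import Literature.NumberTheory.Automorphic.WhittakerCoeffTranslateUnramified
import Literature.NumberTheory.Automorphic.WhittakerDecayCuspForm
import Literature.NumberTheory.Automorphic.WhittakerSupportFinite
import Literature.NumberTheory.Automorphic.RankinSelbergUnramifiedTorus
import Literature.NumberTheory.Automorphic.RankinSelbergTorusPairEuler
import Literature.NumberTheory.Automorphic.RankinSelbergTowerFiniteness

/-!
# The Iwasawa evaluation in torus coordinates for a complex `N_n(𝔸_K)`-invariant integrand

Summit `Langlands`, sub-problem `Langlands`, helper file under `Theorems/` supporting the crux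
`PairLBoundaryJS` (stmt-Langlands-13622), line `Sketch`, registered stub `stub_bochner_iwasawa` (W-Iw):
the Bochner (complex-valued) form of the tree theorem
`Literature.NumberTheory.Automorphic.exists_lintegral_mul_rpow_mul_weight_eq_mul_lintegral_prod`
(`TorusIwasawaTransport`). There is `C > 0`, depending only on the Haar measures `ν`, `νA`, `νK`, with

  `∫_G F(x) |det x|_𝔸^s β(x) dν(x) = C ∫_{(𝔸ˣ)ⁿ × K} F(diag(a) k) torusWeightC s a d(νA ⊗ νK)(a, k)`

for every measurable `F : GL_n(𝔸_K) → ℂ` left-invariant under `N_n(𝔸_K)`, every `s ∈ ℂ` and every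
measurable `N_n(K)`-covering weight `β`, as soon as the left integrand is integrable (and then the right
integrand is integrable) — Cogdell (2004), §2.3; Jacquet–Shalika (1981), §4.

Proof. Put `Φ = F · |det|_𝔸^s`, again measurable and `N_n(𝔸_K)`-invariant (`|det u|_𝔸 = 1` on
`N_n(𝔸_K)`). The `[0, ∞]`-valued identity at the real point `σ = 0`, applied to the indicators of the
level sets `Φ⁻¹(B)` (`B ⊆ ℂ` Borel), says that the push-forward of `β • ν` along `Φ` and `C` times the
push-forward of `torusWeight 0 • (νA ⊗ νK)` along `Φ ∘ torusPoint` are the same measure on `ℂ`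
(`CornerBochnerIwasawa.map_withDensity_eq_smul_map`); integrating `z ↦ z` against both transports
integrability and the integral (`CornerBochnerIwasawa.integrable_and_integral_eq_of_map_eq_smul_map`), and
`torusWeight 0 a · (∏ ‖a_i‖)^s = torusWeightC s a` (`torusWeightC_eq_torusWeight_zero_mul_cpow`).

## References

* J. W. Cogdell, *Analytic theory of L-functions for GL_n*, in *An Introduction to the Langlands
  Program* (2004), §2.3 [CogdellAnalyticTheory2004].
* H. Jacquet, J. A. Shalika, *On Euler products and the classification of automorphic
  representations I*, Amer. J. Math. 103 (1981), §4 [JacquetShalikaAJM1981].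
-/

noncomputable section

-- `Summit.Langlands.Langlands.…` (summit = sub-problem name, D-0017 layout) trips `dupNamespace`
set_option linter.dupNamespace false

open scoped MatrixGroups Topology Pointwise ENNReal NNReal ComplexConjugate InnerProductSpace ContDiff
-- the place subtypes indexing `mixedSpace K` are `Fintype` classically (`NormedCommRing (mixedSpace K)`)
open scoped Classical Matrix.Norms.Operator
open NumberField IsDedekindDomain MeasureTheory Measure Matrix Set Filter WithZero
open NumberField.mixedEmbedding
open Literature.NumberTheory.Automorphic AdelicGroupData
open Literature.NumberTheory.GaloisRepresentations (ideleGroup HeckeCharacter)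
open Literature.MeasureTheory.Group
open Literature.RingTheory.SymmetricFunctions.SymmPoly
open ValuativeRel

-- the automorphic quotient carries the tree's Borel σ-algebra, not Mathlib's quotient σ-algebra
attribute [-instance] Quotient.instMeasurableSpace QuotientGroup.measurableSpace

-- the house local instances, exactly as in `RankinSelbergUnfoldingIdentity`
attribute [local instance] adelicBorel borelSpace_adelic locallyCompactSpace_adelic secondCountableTopology_gl_adelic
  glAdeleBorel borelSpace_glAdele borelSpace_ideleGroup secondCountableTopology_ideleGroup

-- Mathlib idiom: the commutator Lie ring on matrices, to mention `(archGroupGL n K).lie`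
attribute [local instance 100] LieRing.ofAssociativeRing


namespace Summit.Langlands.Langlands.Theorems.CornerBochnerIwasawa

/-! ### Transport of Bochner integrals along equal push-forwards -/

section Pushforward

variable {X Y : Type*} [MeasurableSpace X] [MeasurableSpace Y]

/-- **Transport of a Bochner integral along equal push-forwards.** If the push-forward of `μ` along a
measurable `Φ : X → ℂ` is `C` times the push-forward of `μ'` along `Φ ∘ T` (`T : Y → X` measurable,
`C ∈ (0, ∞)`), and `Φ` is `μ`-integrable, then `Φ ∘ T` is `μ'`-integrable and
`∫ Φ dμ = C ∫ Φ ∘ T dμ'` (both sides are the integral of `z ↦ z` against the common measure on `ℂ`).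
[folklore] -/
theorem integrable_and_integral_eq_of_map_eq_smul_map {μ : Measure X} {μ' : Measure Y} {Φ : X → ℂ}
    {T : Y → X} (hΦ : Measurable Φ) (hT : Measurable T) {C : ℝ≥0∞} (hC0 : C ≠ 0) (hCtop : C ≠ ⊤)
    (h : μ.map Φ = C • μ'.map (Φ ∘ T)) (hint : Integrable Φ μ) :
    Integrable (Φ ∘ T) μ' ∧ ∫ x, Φ x ∂μ = C.toReal • ∫ y, Φ (T y) ∂μ' := by
  have h1 : Integrable (fun z : ℂ => z) (μ.map Φ) :=
    (integrable_map_measure aestronglyMeasurable_id hΦ.aemeasurable).2 hint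
  rw [h, integrable_smul_measure hC0 hCtop] at h1
  have h2 : Integrable (Φ ∘ T) μ' :=
    (integrable_map_measure aestronglyMeasurable_id (hΦ.comp hT).aemeasurable).1 h1
  refine ⟨h2, ?_⟩
  calc ∫ x, Φ x ∂μ = ∫ z, z ∂(μ.map Φ) :=
        (integral_map (f := fun z : ℂ => z) hΦ.aemeasurable aestronglyMeasurable_id).symm
    _ = C.toReal • ∫ z, z ∂(μ'.map (Φ ∘ T)) := by rw [h, integral_smul_measure]
    _ = C.toReal • ∫ y, Φ (T y) ∂μ' := by
        congr 1
        exact integral_map (f := fun z : ℂ => z) (hΦ.comp hT).aemeasurable aestronglyMeasurable_id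

end Pushforward

/-! ### The Bochner Iwasawa evaluation -/

section Iwasawa

variable {n : ℕ} {K : Type} [Field K] [NumberField K]
  [MeasurableSpace (AdeleRing (𝓞 K) K)] [BorelSpace (AdeleRing (𝓞 K) K)]

omit [MeasurableSpace (AdeleRing (𝓞 K) K)] [BorelSpace (AdeleRing (𝓞 K) K)] in
/-- `|det (diag(a) k)|_𝔸 = ∏_i ‖a_i‖` at a torus point (`|det k|_𝔸 = 1` on the maximal compact
subgroup, `det diag(a) = ∏ a_i`). [folklore] -/
theorem ideleNorm_det_torusPoint (p : (Fin n → ideleGroup K) × ↥(maximalCompactAdelic n K)) :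
    IdeleClassGroup.ideleNorm K (Matrix.GeneralLinearGroup.det (torusPoint n K p)) =
      ∏ i, IdeleClassGroup.ideleNorm K (p.1 i) :=
  (ideleNorm_det_mul_maximalCompactAdelic (glDiagonal n (AdeleRing (𝓞 K) K) p.1) p.2).trans
    (by rw [det_glDiagonal, map_prod])

/-- **The equality of push-forwards behind the Bochner Iwasawa evaluation.** For the constant `C` and
the `[0, ∞]` identity `hmain` of `exists_lintegral_mul_rpow_mul_weight_eq_mul_lintegral_prod`, a
measurable `N_n(𝔸_K)`-invariant `Φ : GL_n(𝔸_K) → ℂ` and a measurable `N_n(K)`-covering weight `β`: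
the push-forward of `β • ν` along `Φ` is `C` times the push-forward of `torusWeight 0 • (νA ⊗ νK)`
along `Φ ∘ torusPoint` (the identity at `σ = 0` on the indicators of the level sets `Φ⁻¹(B)`).
[folklore] -/
theorem map_withDensity_eq_smul_map
    (ν : Measure (GL (Fin n) (AdeleRing (𝓞 K) K))) (νA : Measure (Fin n → ideleGroup K))
    (νK : Measure ↥(maximalCompactAdelic n K)) {C : ℝ≥0∞}
    (hmain : ∀ {F : GL (Fin n) (AdeleRing (𝓞 K) K) → ℝ≥0∞}, Measurable F →
        (∀ u : GL (Fin n) (AdeleRing (𝓞 K) K), u ∈ adelicColRange n K 1 (n - 1) → ∀ x, F (u * x) = F x) →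
      ∀ (σ : ℝ) {β : GL (Fin n) (AdeleRing (𝓞 K) K) → ℝ≥0∞}, Measurable β →
        (∀ x, coveringSum ↥(ratPoints (tailUnipotent n K 0)) β x = 1) →
        ∫⁻ x, F x * ENNReal.ofReal ((IdeleClassGroup.ideleNorm K (Matrix.GeneralLinearGroup.det x) : ℝ) ^ σ) *
            β x ∂ν =
          C * ∫⁻ p, F (torusPoint n K p) * ENNReal.ofReal (torusWeight n K σ p.1) ∂(νA.prod νK))
    {Φ : GL (Fin n) (AdeleRing (𝓞 K) K) → ℂ} (hΦm : Measurable Φ)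
    (hΦN : ∀ u : GL (Fin n) (AdeleRing (𝓞 K) K), u ∈ adelicColRange n K 1 (n - 1) → ∀ x, Φ (u * x) = Φ x)
    {β : GL (Fin n) (AdeleRing (𝓞 K) K) → ℝ≥0∞} (hβm : Measurable β)
    (hβ : ∀ x, coveringSum ↥(ratPoints (tailUnipotent n K 0)) β x = 1) :
    (ν.withDensity β).map Φ =
      C • ((νA.prod νK).withDensity fun p => ENNReal.ofReal (torusWeight n K 0 p.1)).map
        (Φ ∘ torusPoint n K) := by
  have htp : Measurable (torusPoint n K) := continuous_torusPoint.measurable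
  refine Measure.ext fun B hB => ?_
  have hBm : MeasurableSet (Φ ⁻¹' B) := hΦm hB
  have hBm' : MeasurableSet ((Φ ∘ torusPoint n K) ⁻¹' B) := (hΦm.comp htp) hB
  rw [Measure.map_apply hΦm hB, withDensity_apply _ hBm, Measure.smul_apply, smul_eq_mul,
    Measure.map_apply (hΦm.comp htp) hB, withDensity_apply _ hBm', ← lintegral_indicator hBm,
    ← lintegral_indicator hBm']
  -- the `[0, ∞]` identity at `σ = 0` for the indicator of the `N_n(𝔸_K)`-invariant level set `Φ⁻¹(B)`
  have h := hmain (F := (Φ ⁻¹' B).indicator 1) (measurable_one.indicator hBm)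
    (fun u hu x => by simp only [Set.indicator_apply, Set.mem_preimage, Pi.one_apply, hΦN u hu x]) 0 hβm hβ
  simp only [Real.rpow_zero, ENNReal.ofReal_one, mul_one] at h
  have e1 : ∀ x, (Φ ⁻¹' B).indicator β x = (Φ ⁻¹' B).indicator 1 x * β x := fun x => by
    by_cases hx : x ∈ Φ ⁻¹' B
    · rw [Set.indicator_of_mem hx, Set.indicator_of_mem hx, Pi.one_apply, one_mul]
    · rw [Set.indicator_of_notMem hx, Set.indicator_of_notMem hx, zero_mul]
  have e2 : ∀ p : (Fin n → ideleGroup K) × ↥(maximalCompactAdelic n K),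
      ((Φ ∘ torusPoint n K) ⁻¹' B).indicator (fun p => ENNReal.ofReal (torusWeight n K 0 p.1)) p =
        (Φ ⁻¹' B).indicator 1 (torusPoint n K p) * ENNReal.ofReal (torusWeight n K 0 p.1) := fun p => by
    by_cases hp : torusPoint n K p ∈ Φ ⁻¹' B
    · rw [Set.indicator_of_mem (show p ∈ (Φ ∘ torusPoint n K) ⁻¹' B from hp), Set.indicator_of_mem hp,
        Pi.one_apply, one_mul]
    · rw [Set.indicator_of_notMem (show p ∉ (Φ ∘ torusPoint n K) ⁻¹' B from hp),
        Set.indicator_of_notMem hp, zero_mul]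
  exact (lintegral_congr e1).trans (h.trans (congrArg (C * ·) (lintegral_congr fun p => (e2 p).symm)))

end Iwasawa

/-- **The Iwasawa evaluation in torus coordinates for a COMPLEX `N_n(𝔸_K)`-invariant integrand**
(Bochner form of `exists_lintegral_mul_rpow_mul_weight_eq_mul_lintegral_prod`; Cogdell (2004), §2.3;
Jacquet–Shalika (1981), §4). Let `0 < n`, `ν` a Haar measure on `GL_n(𝔸_K)`, `νA` a Haar measure on
`(𝔸_Kˣ)ⁿ` and `νK` a Haar measure on `K = maximalCompactAdelic n K`. There is `C > 0`, depending only on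
the measures, such that for every measurable `F : GL_n(𝔸_K) → ℂ` left-invariant under `N_n(𝔸_K)`, every
`s ∈ ℂ` and every measurable `N_n(K)`-covering weight `β`: if `F |det|_𝔸^s β` is `ν`-integrable, then
`(a, k) ↦ F(diag(a) k) torusWeightC s a` is `νA ⊗ νK`-integrable and

  `∫ F(x) |det x|_𝔸^s β(x) dν(x) = C ∫ F(diag(a) k) torusWeightC s a d(νA ⊗ νK)(a, k)`.

[cite: CogdellAnalyticTheory2004, §2.3] -/
theorem stub_bochner_iwasawa :
    ∀ {n : ℕ} {K : Type} [Field K] [NumberField K]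
      [MeasurableSpace (AdeleRing (𝓞 K) K)] [BorelSpace (AdeleRing (𝓞 K) K)] (_hn : 0 < n)
      (ν : Measure (GL (Fin n) (AdeleRing (𝓞 K) K))) [ν.IsHaarMeasure]
      (νA : Measure (Fin n → ideleGroup K)) [IsHaarMeasure νA]
      (νK : Measure ↥(maximalCompactAdelic n K)) [IsHaarMeasure νK],
      ∃ C : ℝ, 0 < C ∧
        ∀ {F : GL (Fin n) (AdeleRing (𝓞 K) K) → ℂ}, Measurable F →
          (∀ u : GL (Fin n) (AdeleRing (𝓞 K) K), u ∈ adelicColRange n K 1 (n - 1) → ∀ x, F (u * x) = F x) →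
        ∀ (s : ℂ) {β : GL (Fin n) (AdeleRing (𝓞 K) K) → ℝ≥0∞}, Measurable β →
          (∀ x, coveringSum ↥(ratPoints (tailUnipotent n K 0)) β x = 1) →
          Integrable (fun x => F x *
            ((((IdeleClassGroup.ideleNorm K (Matrix.GeneralLinearGroup.det x) : ℝ≥0) : ℝ) : ℂ)) ^ s *
            ((β x).toReal : ℂ)) ν →
          Integrable (fun p => F (torusPoint n K p) * torusWeightC n K s p.1) (νA.prod νK) ∧
          ∫ x, F x * ((((IdeleClassGroup.ideleNorm K (Matrix.GeneralLinearGroup.det x) : ℝ≥0) : ℝ) : ℂ)) ^ s *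
              ((β x).toReal : ℂ) ∂ν =
            (C : ℂ) * ∫ p, F (torusPoint n K p) * torusWeightC n K s p.1 ∂(νA.prod νK) := by
  intro n K _ _ _ _ hn ν _ νA _ νK _
  obtain ⟨C, hC0, hCtop, hmain⟩ :=
    exists_lintegral_mul_rpow_mul_weight_eq_mul_lintegral_prod (K := K) hn ν νA νK
  refine ⟨C.toReal, ENNReal.toReal_pos hC0 hCtop, fun {F} hF hFN s {β} hβm hβ hint => ?_⟩
  -- `x ↦ |det x|_𝔸 ∈ ℝ` is measurable
  have hrm : Measurable fun x : GL (Fin n) (AdeleRing (𝓞 K) K) =>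
      ((IdeleClassGroup.ideleNorm K (Matrix.GeneralLinearGroup.det x) : ℝ≥0) : ℝ) :=
    measurable_subtype_coe.comp ((continuous_ideleNorm_holds K).measurable.comp
      Matrix.GeneralLinearGroup.continuous_det.measurable)
  -- the twisted integrand `Φ = F |det|_𝔸^s`, measurable and `N_n(𝔸_K)`-invariant
  set Φ : GL (Fin n) (AdeleRing (𝓞 K) K) → ℂ := fun x =>
    F x * ((((IdeleClassGroup.ideleNorm K (Matrix.GeneralLinearGroup.det x) : ℝ≥0) : ℝ) : ℂ)) ^ s with hΦ
  have hΦm : Measurable Φ := hF.mul ((Complex.measurable_ofReal.comp hrm).pow_const _)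
  have hΦN : ∀ u : GL (Fin n) (AdeleRing (𝓞 K) K), u ∈ adelicColRange n K 1 (n - 1) →
      ∀ x, Φ (u * x) = Φ x := by
    intro u hu x
    simp only [hΦ, hFN u hu x, map_mul, ideleNorm_det_eq_one_of_mem_adelicColRange hu, one_mul]
  have htp : Measurable (torusPoint n K) := continuous_torusPoint.measurable
  -- the weights are finite
  have hβtop : ∀ x, β x < ⊤ := fun x => by
    have h := lt_top_of_coveringSum_ne_top (Γ := ↥(ratPoints (tailUnipotent n K 0)))
      (show coveringSum ↥(ratPoints (tailUnipotent n K 0)) β x ≠ ⊤ by rw [hβ x]; exact ENNReal.one_ne_top) 1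
    rwa [one_smul] at h
  have hWm : Measurable fun p : (Fin n → ideleGroup K) × ↥(maximalCompactAdelic n K) =>
      ENNReal.ofReal (torusWeight n K 0 p.1) :=
    ENNReal.measurable_ofReal.comp ((continuous_torusWeight 0).measurable.comp measurable_fst)
  have hWtop : ∀ p : (Fin n → ideleGroup K) × ↥(maximalCompactAdelic n K),
      ENNReal.ofReal (torusWeight n K 0 p.1) < ⊤ := fun p => ENNReal.ofReal_lt_top
  -- the two push-forwards to `ℂ` agree; transport integrability and the integral
  have hmap := map_withDensity_eq_smul_map ν νA νK hmain hΦm hΦN hβm hβ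
  have hint' : Integrable Φ (ν.withDensity β) := by
    rw [integrable_withDensity_iff_integrable_smul' hβm (Eventually.of_forall hβtop)]
    refine hint.congr (Eventually.of_forall fun x => ?_)
    simp only [hΦ, Complex.real_smul]
    ring
  obtain ⟨hT, hTeq⟩ := integrable_and_integral_eq_of_map_eq_smul_map hΦm htp hC0 hCtop hmap hint'
  -- back to the integrand of the statement in torus coordinates
  have key : ∀ p : (Fin n → ideleGroup K) × ↥(maximalCompactAdelic n K),
      (ENNReal.ofReal (torusWeight n K 0 p.1)).toReal • Φ (torusPoint n K p) =
        F (torusPoint n K p) * torusWeightC n K s p.1 := by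
    intro p
    simp only [hΦ]
    rw [ENNReal.toReal_ofReal (torusWeight_nonneg 0 p.1), Complex.real_smul, ideleNorm_det_torusPoint,
      NNReal.coe_prod, torusWeightC_eq_torusWeight_zero_mul_cpow]
    ring
  refine ⟨((integrable_withDensity_iff_integrable_smul' hWm (Eventually.of_forall hWtop)).1 hT).congr
    (Eventually.of_forall key), ?_⟩
  calc ∫ x, F x * ((((IdeleClassGroup.ideleNorm K (Matrix.GeneralLinearGroup.det x) : ℝ≥0) : ℝ) : ℂ)) ^ s *
          ((β x).toReal : ℂ) ∂ν
      = ∫ x, (β x).toReal • Φ x ∂ν :=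
        integral_congr_ae (Eventually.of_forall fun x => by simp only [hΦ, Complex.real_smul]; ring)
    _ = ∫ x, Φ x ∂(ν.withDensity β) :=
        (integral_withDensity_eq_integral_toReal_smul hβm (Eventually.of_forall hβtop) Φ).symm
    _ = C.toReal • ∫ p, Φ (torusPoint n K p)
          ∂((νA.prod νK).withDensity fun p => ENNReal.ofReal (torusWeight n K 0 p.1)) := hTeq
    _ = C.toReal • ∫ p, (ENNReal.ofReal (torusWeight n K 0 p.1)).toReal • Φ (torusPoint n K p) ∂(νA.prod νK) := by
        rw [integral_withDensity_eq_integral_toReal_smul hWm (Eventually.of_forall hWtop)]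
    _ = (C.toReal : ℂ) * ∫ p, F (torusPoint n K p) * torusWeightC n K s p.1 ∂(νA.prod νK) := by
        rw [integral_congr_ae (Eventually.of_forall key), Complex.real_smul]

end Summit.Langlands.Langlands.Theorems.CornerBochnerIwasawa

end
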